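import Summits.QuantumFields.YangMills.Theorems.VirialFluxGapSharpTwistedLaplaceQuantitativeLaplaceMethod
import Literature.Analysis.Asymptotics.LaplaceMethodOrbit
import HarnessLib

/-!
# Laplace's method with an explicit `O(1/β)` remainder ON A NON-DEGENERATE CRITICAL ORBIT
# (the quantitative twin of `Literature.Analysis.Asymptotics.tendsto_laplaceMethod_orbit`)

Helper module (free-hands work of width seat ym-line-sfw-p2-w2 g49, cell ym-idea-1) toward crux
⟨stmt-QuantumFields-24204⟩ `VirialFluxGap.SharpTwistedLaplace` by the DIRECT Laplace method at the twist-eater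
orbits; PART 4 of the quantitative Laplace stack (parts 1–3 = `…QuantitativeLaplace{Gauss,Pointwise,Method}`, the
Euclidean core ★★ `laplaceMethod_quantitative(_of_eqOn)`).  Everything here is PROVED; no definitions, no named
facts (namespace `Summit.QuantumFields.YangMills.Theorems.QuantitativeLaplace`).

THE STATEMENTS (★★ `laplaceMethod_quantitative_orbit_tube` — the tube part alone, no hypothesis off the tube;
★★ `laplaceMethod_quantitative_orbit` — with separation off the tube; ★ `laplaceMethod_quantitative_sum_of_tubes` —
the bookkeeping over finitely many disjoint tubes, the quantitative twin of `tendsto_laplaceMethod_sum_of_tubes`).  The setting is VERBATIM that of the tree's limit theorem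
`tendsto_laplaceMethod_orbit` (`Literature/Analysis/Asymptotics/LaplaceMethodOrbit.lean`, itself built on
`MeasureTheory/Group/OrbitTubeMeasure.lean`): an instance-free measurable action `act` of a group `K` on a
FINITE measure space `(X, μ)` by `μ`-preserving maps, a finite bi-invariant `ν` on `K`, a transversal
`σ : V → X` with window the closed ball `‖y‖ ≤ R`, tube `T = Θ(K × B̄_R)`, a local window `Θ'(Φ × B̄_R)` with the
local chart identity `hloc` for a real density `J ≥ 0`, the slice property for a set `S` fixing `σ(B̄_R)`,
`0 < ν(((eΦ)·S)⁻¹) < ∞`, `act`-invariant measurable phase `f` and amplitude `φ`.  The QUALITATIVE one-point data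
(Peano expansion, continuity) are replaced by the QUANTITATIVE data of the Euclidean core on the ball: with the
averaged transversal density `j(y) = (∫_Φ J(z,y)dκ) ∕ ν(((eΦ)·S)⁻¹)`,
`f(σ y) − f(σ 0) = ½⟪Ay,y⟫ + c + r`, `j(y)·φ(σ y) = w₀(1 + ℓ + e)` (`c`, `ℓ` odd, `|c| ≤ A₃‖y‖³`, `|r| ≤ A₄‖y‖⁴`,
`|ℓ| ≤ D‖y‖`, `|e| ≤ G‖y‖²`, `A₃R + A₄R² ≤ λ/(8(m+8))`, `DR ≤ 1`, `GR² ≤ 1`, `λ‖y‖² ≤ ⟪Ay,y⟫`), plus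
`f ≥ f(σ 0) + η₀` OFF the tube and `|φ| ≤ Φ₀`.  THEN for every `β > 0`

  `|∫_X e^{−β(f − f(σ0))} φ dμ − ν(K)·w₀·𝔊(β)| ≤ (K/β)·ν(K)·w₀·𝔊(β) + Φ₀·μ(X)·e^{−βη₀}`,

`𝔊(β) = (2π/β)^{m/2}/√det A`, with the SAME explicit polynomial constant `K` as the Euclidean core.  Proof = the
proof of `tendsto_laplaceMethod_orbit` with the limit step replaced by the inequality: the orbit-tube
globalisation `OrbitTubeMeasure.restrict_tube_eq_map_withDensity_ofReal` of `hloc`, the chart pull-back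
`setIntegral_image_eq_of_chart`, invariance (the integrand in tube coordinates depends on the transversal
coordinate only), Fubini (`integral_prod_mul`), ★★ `laplaceMethod_quantitative_of_eqOn`; the complement of
the tube costs `Φ₀ μ(X) e^{−βη₀}`.

WHY.  With the ring-history (or the ym-ir twisted-slab K-files') orbit ∕ slice charts supplied with `poly(L)`
bounds, this is the statement that turns the twist-eater orbits of `F_z` into
`log ∫ e^{−βF_z} = −9L⁴ log β + C(L,z) ± K L^q/β` on the window `β ≥ poly(L)` of ⟨24204⟩.

HONEST FRAMING: classical analysis ∕ measure theory; width 0 by itself toward any lattice statement; ⟨24204⟩,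
⟨24319⟩ and every rung stay OPEN; the Yang–Mills mass gap (Clay) is NOT touched; no summit is proved by a line.

## References
* E. Hasenpflug, D. Rudolf, B. Sprungk, Ann. Appl. Probab. 34 (2024), §3.1 Assumption 3, App. 4.1 Thm 16. [HasenpflugRudolfSprungk2024]
* K. W. Breitung, *Asymptotic Approximations for Probability Integrals*, LNM 1592 (1994), Thm 41 p. 56, §2.3. [Breitung1994]
* C. Searle, in Dearricott et al., LNM 2110 (2014), Def. 1.11, PDF pp. 34–35 (tubes `K ×_S B`). [DearricottEtAl2014]
-/

noncomputable section

open _root_.MeasureTheory _root_.MeasureTheory.Measure _root_.Filter _root_.Set _root_.Module _root_.Metric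
open scoped _root_.Topology _root_.Real _root_.InnerProductSpace _root_.ENNReal _root_.NNReal _root_.Pointwise

namespace Summit.QuantumFields.YangMills.Theorems.QuantitativeLaplace

open Literature.Analysis.Asymptotics Literature.MeasureTheory.Group

variable {V : Type*} [NormedAddCommGroup V] [InnerProductSpace ℝ V] [FiniteDimensional ℝ V]
  [MeasurableSpace V] [BorelSpace V]
variable {K X Z : Type*} [Group K] [MeasurableSpace K] [MeasurableMul K] [MeasurableInv K]
  [MeasurableSpace X] [MeasurableSpace Z]
  {act : K → X → X} {σ : V → X} {e : Z → K} {Θ : K × V → X} {Θ' : Z × V → X}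
  {Φ : Set Z} {S : Set K}
  {ν : Measure K} [IsMulLeftInvariant ν] [IsMulRightInvariant ν] [IsFiniteMeasure ν]
  {μ : Measure X} [IsFiniteMeasure μ] {κ : Measure Z} [SFinite κ]

/-- ★★ **The TUBE part, quantitatively**: under the structural hypotheses of `tendsto_laplaceMethod_orbit` (tube
`T = Θ(K × B̄_R)`, local chart identity `hloc`, slice property) and the quantitative window data of the Euclidean
core for the invariant phase `f` and amplitude `φ` along the transversal `σ`, the integrand
`e^{−β(f − f(σ0))}φ` is integrable on the tube and
`|∫_T e^{−β(f − f(σ0))} φ dμ − ν(K)·w₀·𝔊(β)| ≤ (K/β)·ν(K)·w₀·𝔊(β)` with the explicit polynomial `K` of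
`laplaceMethod_quantitative` — no hypothesis off the tube (sum this over finitely many disjoint tubes and add
the separated complement: `laplaceMethod_quantitative_sum_of_tubes`).
[cite: HasenpflugRudolfSprungk2024, §3.1 Assumption 3 and App. 4.1 Thm 16]
[cite: Breitung1994, Thm 41 p. 56 with §2.3 Definitions 4–5 pp. 14–15]
[cite: DearricottEtAl2014, (Searle) Def. 1.11, PDF pp. 34–35] -/
theorem laplaceMethod_quantitative_orbit_tube
    (hact : Measurable fun p : K × X => act p.1 p.2)
    (hmul : ∀ k k' x, act (k * k') x = act k (act k' x)) (hone : ∀ x, act 1 x = x)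
    (hpres : ∀ k, MeasurePreserving (act k) μ μ) (hσ : Measurable σ)
    (hΘ : ∀ k y, Θ (k, y) = act k (σ y)) (hΘm : Measurable Θ)
    (hΘ' : ∀ z y, Θ' (z, y) = act (e z) (σ y)) (hΘ'm : Measurable Θ')
    {R : ℝ} (hR : 0 < R)
    (hslice : ∀ k : K, ∀ y ∈ closedBall (0 : V) R, ∀ y' ∈ closedBall (0 : V) R, act k (σ y) = σ y' → k ∈ S)
    (hfix : ∀ s ∈ S, ∀ y ∈ closedBall (0 : V) R, act s (σ y) = σ y)
    (hT : MeasurableSet (Θ '' (univ ×ˢ closedBall (0 : V) R)))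
    (hA : MeasurableSet (Θ' '' (Φ ×ˢ closedBall (0 : V) R))) (hΦ : MeasurableSet Φ)
    {J : Z × V → ℝ} (hJm : Measurable J) (hJ0 : ∀ z ∈ Φ, ∀ y ∈ closedBall (0 : V) R, 0 ≤ J (z, y))
    (hJint : ∀ y ∈ closedBall (0 : V) R, IntegrableOn (fun z => J (z, y)) Φ κ)
    (hloc : μ.restrict (Θ' '' (Φ ×ˢ closedBall (0 : V) R)) =
      (((κ.prod volume).restrict (Φ ×ˢ closedBall (0 : V) R)).withDensity
        fun w => ENNReal.ofReal (J w)).map Θ')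
    (hc0 : ν (((e '' Φ) * S)⁻¹) ≠ 0) (hctop : ν (((e '' Φ) * S)⁻¹) ≠ ∞)
    {f φ : X → ℝ} (hfm : Measurable f) (hφm : Measurable φ)
    (hfinv : ∀ k x, f (act k x) = f x) (hφinv : ∀ k x, φ (act k x) = φ x)
    {A : V →ₗ[ℝ] V} {lam : ℝ} (hAs : A.IsSymmetric) (hlam : 0 < lam)
    (hcoer : ∀ y : V, lam * ‖y‖ ^ 2 ≤ ⟪A y, y⟫_ℝ)
    {A₃ A₄ D G β w₀ : ℝ} (hA₃ : 0 ≤ A₃) (hA₄ : 0 ≤ A₄) (hD : 0 ≤ D) (hG : 0 ≤ G)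
    (hβ : 0 < β) (hw₀ : 0 ≤ w₀)
    (hsmall : A₃ * R + A₄ * R ^ 2 ≤ lam / (8 * ((finrank ℝ V : ℝ) + 8)))
    (hDR : D * R ≤ 1) (hGR : G * R ^ 2 ≤ 1)
    {cc rr ll ee : V → ℝ} (hc_meas : Measurable cc) (hr_meas : Measurable rr) (hℓ_meas : Measurable ll)
    (he_meas : Measurable ee) (hc_odd : ∀ y, cc (-y) = -cc y) (hℓ_odd : ∀ y, ll (-y) = -ll y)
    (hc : ∀ y : V, ‖y‖ ≤ R → |cc y| ≤ A₃ * ‖y‖ ^ 3) (hr : ∀ y : V, ‖y‖ ≤ R → |rr y| ≤ A₄ * ‖y‖ ^ 4)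
    (hℓ : ∀ y : V, ‖y‖ ≤ R → |ll y| ≤ D * ‖y‖) (he : ∀ y : V, ‖y‖ ≤ R → |ee y| ≤ G * ‖y‖ ^ 2)
    (hf : ∀ y : V, ‖y‖ ≤ R → f (σ y) - f (σ 0) = (1 / 2) * ⟪A y, y⟫_ℝ + cc y + rr y)
    (hw : ∀ y : V, ‖y‖ ≤ R →
      ((∫ z in Φ, J (z, y) ∂κ) / (ν (((e '' Φ) * S)⁻¹)).toReal) * φ (σ y) = w₀ * (1 + ll y + ee y)) :
    IntegrableOn (fun x => Real.exp (-(β * (f x - f (σ 0)))) * φ x) (Θ '' (univ ×ˢ closedBall (0 : V) R)) μ ∧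
    |(∫ x in Θ '' (univ ×ˢ closedBall (0 : V) R), Real.exp (-(β * (f x - f (σ 0)))) * φ x ∂μ) -
        ν.real univ * (w₀ * ((2 * π / β) ^ ((finrank ℝ V : ℝ) / 2) / Real.sqrt (LinearMap.det A)))| ≤ (16 * ((finrank ℝ V : ℝ) + 8) / (lam * R ^ 2) + 16 * G * ((finrank ℝ V : ℝ) + 8) / lam
        + 256 * (A₄ + (A₃ + A₄ * R) * (D + G * R)) * ((finrank ℝ V : ℝ) + 8) ^ 2 / lam ^ 2
        + 18432 * (A₃ + A₄ * R) ^ 2 * ((finrank ℝ V : ℝ) + 8) ^ 3 / lam ^ 3) / β * (ν.real univ * (w₀ * ((2 * π / β) ^ ((finrank ℝ V : ℝ) / 2) / Real.sqrt (LinearMap.det A)))) := by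
  set B : Set V := closedBall (0 : V) R with hBdef
  have hB : MeasurableSet B := measurableSet_closedBall
  set cν : ℝ≥0∞ := ν (((e '' Φ) * S)⁻¹) with hcν
  set j : V → ℝ := fun y => (∫ z in Φ, J (z, y) ∂κ) / cν.toReal with hjdef
  set f₀ : ℝ := f (σ 0) with hf₀
  set F : X → ℝ := fun x => Real.exp (-(β * (f x - f₀))) * φ x with hFdef
  set 𝔊 : ℝ := ((2 * π / β) ^ ((finrank ℝ V : ℝ) / 2) / Real.sqrt (LinearMap.det A)) with h𝔊
  have hcpos : 0 < cν.toReal := ENNReal.toReal_pos hc0 hctop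
  have hjm : Measurable j := by
    have h1 : StronglyMeasurable fun y => ∫ z, J (z, y) ∂κ.restrict Φ :=
      hJm.stronglyMeasurable.integral_prod_left'
    exact h1.measurable.div_const _
  have hJ'm : Measurable fun z : K × V => j z.2 := hjm.comp measurable_snd
  have hJ'0 : ∀ z ∈ (univ : Set K) ×ˢ B, 0 ≤ j z.2 := by
    rintro ⟨k, y⟩ ⟨-, hy⟩
    exact div_nonneg (setIntegral_nonneg hΦ fun z hz => hJ0 z hz y hy) hcpos.le
  -- ★ the global fibred chart identity (orbit-tube globalisation of `hloc`)
  have hchart : μ.restrict (Θ '' (univ ×ˢ B)) =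
      (((ν.prod volume).restrict (univ ×ˢ B)).withDensity fun z => ENNReal.ofReal (j z.2)).map Θ :=
    restrict_tube_eq_map_withDensity_ofReal hact hmul hone hpres hσ hΘ hΘm hΘ' hΘ'm hslice hfix hT hA hB hΦ
      hJm hJ0 hJint hloc hc0 hctop
  have hΘf : ∀ k y, f (Θ (k, y)) = f (σ y) := fun k y => by rw [hΘ, hfinv]
  have hΘφ : ∀ k y, φ (Θ (k, y)) = φ (σ y) := fun k y => by rw [hΘ, hφinv]
  have hFm : Measurable F := (((hfm.sub measurable_const).const_mul β).neg.exp).mul hφm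
  -- the transversal integrand `g y = e^{−β(f(σy) − f₀)} · (j y · φ(σ y))`
  set g : V → ℝ := fun y => Real.exp (-(β * (f (σ y) - f₀))) * (j y * φ (σ y)) with hgdef
  have hgm : Measurable g :=
    ((((hfm.comp hσ).sub measurable_const).const_mul β).neg.exp).mul (hjm.mul (hφm.comp hσ))
  have hjF : ∀ z : K × V, j z.2 * F (Θ z) = g z.2 := by
    rintro ⟨k, y⟩
    simp only [hFdef, hgdef, hΘf, hΘφ]
    ring
  -- bound of the transversal integrand on the ball (Euclidean core, part 2/3)
  have hgbd : ∀ y ∈ B, |g y| ≤ 3 * w₀ := by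
    intro y hy
    have hyR : ‖y‖ ≤ R := by simpa [hBdef] using hy
    have h3 := laplace_abs_integrand_le_three hlam hcoer hA₃ hA₄ hD hG hβ hsmall hDR hGR hc hr hℓ he y hyR
    have hgy : g y = w₀ * (Real.exp (-(β * (((1 / 2) * ⟪A y, y⟫_ℝ) + cc y + rr y))) * (1 + ll y + ee y)) := by
      simp only [hgdef]
      rw [hf y hyR, mul_comm (j y) (φ (σ y)), ← mul_assoc, mul_assoc (Real.exp _), mul_comm (φ (σ y)) (j y)]
      rw [show j y * φ (σ y) = w₀ * (1 + ll y + ee y) from hw y hyR]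
      ring
    rw [hgy, abs_mul, abs_of_nonneg hw₀]
    calc w₀ * |Real.exp (-(β * (((1 / 2) * ⟪A y, y⟫_ℝ) + cc y + rr y))) * (1 + ll y + ee y)| ≤ w₀ * 3 :=
        mul_le_mul_of_nonneg_left h3 hw₀
      _ = 3 * w₀ := by ring
  -- integrability on the tube through the chart
  have hprodfin : (ν.prod volume) ((univ : Set K) ×ˢ B) ≠ ∞ := by
    rw [Measure.prod_prod]
    exact ENNReal.mul_ne_top (measure_ne_top ν _) (by rw [hBdef]; exact measure_closedBall_lt_top.ne)
  have hgint : IntegrableOn (fun z : K × V => j z.2 * F (Θ z)) ((univ : Set K) ×ˢ B) (ν.prod volume) := by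
    exact Measure.integrableOn_of_bounded (M := 3 * w₀) hprodfin (hJ'm.mul (hFm.comp hΘm)).aestronglyMeasurable
      ((ae_restrict_iff' (MeasurableSet.univ.prod hB)).mpr (Eventually.of_forall fun z hz => by
        rw [Real.norm_eq_abs, hjF z]
        exact hgbd z.2 hz.2))
  have hTint : IntegrableOn F (Θ '' (univ ×ˢ B)) μ :=
    (integrableOn_image_iff_of_chart hΘm (MeasurableSet.univ.prod hB) hJ'm hJ'0 hchart hFm).mpr hgint
  -- ★ the tube integral in transversal coordinates
  have htube : ∫ x in Θ '' (univ ×ˢ B), F x ∂μ = ν.real univ * ∫ y in B, g y := by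
    rw [setIntegral_image_eq_of_chart hΘm (MeasurableSet.univ.prod hB) hJ'm hJ'0 hchart hFm]
    have h1 : ∫ z in (univ : Set K) ×ˢ B, j z.2 * F (Θ z) ∂(ν.prod volume) =
        ∫ z, (fun _ : K => (1 : ℝ)) z.1 * g z.2 ∂(ν.prod (volume.restrict B)) := by
      rw [← Measure.restrict_univ (μ := ν), ← Measure.prod_restrict, Measure.restrict_univ]
      refine integral_congr_ae (Eventually.of_forall fun z => ?_)
      simp only [hjF z, one_mul]
    rw [h1, integral_prod_mul (μ := ν) (ν := volume.restrict B) (fun _ : K => (1 : ℝ)) g, integral_const,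
      smul_eq_mul, mul_one]
  -- ★ the Euclidean core on the transversal ball
  have hcore : |(∫ y in B, g y) - w₀ * 𝔊| ≤ (16 * ((finrank ℝ V : ℝ) + 8) / (lam * R ^ 2) + 16 * G * ((finrank ℝ V : ℝ) + 8) / lam
        + 256 * (A₄ + (A₃ + A₄ * R) * (D + G * R)) * ((finrank ℝ V : ℝ) + 8) ^ 2 / lam ^ 2
        + 18432 * (A₃ + A₄ * R) ^ 2 * ((finrank ℝ V : ℝ) + 8) ^ 3 / lam ^ 3) / β * (w₀ * 𝔊) := by
    rw [hBdef, h𝔊]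
    exact laplaceMethod_quantitative_of_eqOn (f := fun y => f (σ y) - f₀) (w := fun y => j y * φ (σ y))
      hAs hlam hcoer hR hA₃ hA₄ hD hG hβ hw₀ hsmall hDR hGR hc_meas hr_meas hℓ_meas he_meas hc_odd hℓ_odd
      hc hr hℓ he hf hw
  have hν0 : 0 ≤ ν.real univ := measureReal_nonneg
  refine ⟨hTint, ?_⟩
  rw [htube, ← mul_sub, abs_mul, abs_of_nonneg hν0]
  calc ν.real univ * |(∫ y in B, g y) - w₀ * 𝔊| ≤ ν.real univ * ((16 * ((finrank ℝ V : ℝ) + 8) / (lam * R ^ 2) + 16 * G * ((finrank ℝ V : ℝ) + 8) / lam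
        + 256 * (A₄ + (A₃ + A₄ * R) * (D + G * R)) * ((finrank ℝ V : ℝ) + 8) ^ 2 / lam ^ 2
        + 18432 * (A₃ + A₄ * R) ^ 2 * ((finrank ℝ V : ℝ) + 8) ^ 3 / lam ^ 3) / β * (w₀ * 𝔊)) :=
        mul_le_mul_of_nonneg_left hcore hν0
    _ = _ := by ring

/-- ★★ **Laplace's method on a non-degenerate critical orbit with an explicit `O(1/β)` remainder** — the
quantitative twin of `tendsto_laplaceMethod_orbit` (same structural hypotheses; one-point data replaced by the
quantitative window data of `laplaceMethod_quantitative_of_eqOn`; separation `f ≥ f(σ0) + η₀` off the tube and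
`|φ| ≤ Φ₀`; see the module docstring).
[cite: HasenpflugRudolfSprungk2024, §3.1 Assumption 3 and App. 4.1 Thm 16]
[cite: Breitung1994, Thm 41 p. 56 with §2.3 Definitions 4–5 pp. 14–15]
[cite: DearricottEtAl2014, (Searle) Def. 1.11, PDF pp. 34–35] -/
theorem laplaceMethod_quantitative_orbit
    (hact : Measurable fun p : K × X => act p.1 p.2)
    (hmul : ∀ k k' x, act (k * k') x = act k (act k' x)) (hone : ∀ x, act 1 x = x)
    (hpres : ∀ k, MeasurePreserving (act k) μ μ) (hσ : Measurable σ)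
    (hΘ : ∀ k y, Θ (k, y) = act k (σ y)) (hΘm : Measurable Θ)
    (hΘ' : ∀ z y, Θ' (z, y) = act (e z) (σ y)) (hΘ'm : Measurable Θ')
    {R : ℝ} (hR : 0 < R)
    (hslice : ∀ k : K, ∀ y ∈ closedBall (0 : V) R, ∀ y' ∈ closedBall (0 : V) R, act k (σ y) = σ y' → k ∈ S)
    (hfix : ∀ s ∈ S, ∀ y ∈ closedBall (0 : V) R, act s (σ y) = σ y)
    (hT : MeasurableSet (Θ '' (univ ×ˢ closedBall (0 : V) R)))
    (hA : MeasurableSet (Θ' '' (Φ ×ˢ closedBall (0 : V) R))) (hΦ : MeasurableSet Φ)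
    {J : Z × V → ℝ} (hJm : Measurable J) (hJ0 : ∀ z ∈ Φ, ∀ y ∈ closedBall (0 : V) R, 0 ≤ J (z, y))
    (hJint : ∀ y ∈ closedBall (0 : V) R, IntegrableOn (fun z => J (z, y)) Φ κ)
    (hloc : μ.restrict (Θ' '' (Φ ×ˢ closedBall (0 : V) R)) =
      (((κ.prod volume).restrict (Φ ×ˢ closedBall (0 : V) R)).withDensity
        fun w => ENNReal.ofReal (J w)).map Θ')
    (hc0 : ν (((e '' Φ) * S)⁻¹) ≠ 0) (hctop : ν (((e '' Φ) * S)⁻¹) ≠ ∞)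
    {f φ : X → ℝ} (hfm : Measurable f) (hφm : Measurable φ)
    (hfinv : ∀ k x, f (act k x) = f x) (hφinv : ∀ k x, φ (act k x) = φ x)
    {A : V →ₗ[ℝ] V} {lam : ℝ} (hAs : A.IsSymmetric) (hlam : 0 < lam)
    (hcoer : ∀ y : V, lam * ‖y‖ ^ 2 ≤ ⟪A y, y⟫_ℝ)
    {A₃ A₄ D G β w₀ η₀ Φ₀ : ℝ} (hA₃ : 0 ≤ A₃) (hA₄ : 0 ≤ A₄) (hD : 0 ≤ D) (hG : 0 ≤ G)
    (hβ : 0 < β) (hw₀ : 0 ≤ w₀)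
    (hsmall : A₃ * R + A₄ * R ^ 2 ≤ lam / (8 * ((finrank ℝ V : ℝ) + 8)))
    (hDR : D * R ≤ 1) (hGR : G * R ^ 2 ≤ 1)
    {cc rr ll ee : V → ℝ} (hc_meas : Measurable cc) (hr_meas : Measurable rr) (hℓ_meas : Measurable ll)
    (he_meas : Measurable ee) (hc_odd : ∀ y, cc (-y) = -cc y) (hℓ_odd : ∀ y, ll (-y) = -ll y)
    (hc : ∀ y : V, ‖y‖ ≤ R → |cc y| ≤ A₃ * ‖y‖ ^ 3) (hr : ∀ y : V, ‖y‖ ≤ R → |rr y| ≤ A₄ * ‖y‖ ^ 4)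
    (hℓ : ∀ y : V, ‖y‖ ≤ R → |ll y| ≤ D * ‖y‖) (he : ∀ y : V, ‖y‖ ≤ R → |ee y| ≤ G * ‖y‖ ^ 2)
    (hf : ∀ y : V, ‖y‖ ≤ R → f (σ y) - f (σ 0) = (1 / 2) * ⟪A y, y⟫_ℝ + cc y + rr y)
    (hw : ∀ y : V, ‖y‖ ≤ R →
      ((∫ z in Φ, J (z, y) ∂κ) / (ν (((e '' Φ) * S)⁻¹)).toReal) * φ (σ y) = w₀ * (1 + ll y + ee y))
    (hout : ∀ x, x ∉ Θ '' (univ ×ˢ closedBall (0 : V) R) → f (σ 0) + η₀ ≤ f x)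
    (hφb : ∀ x, |φ x| ≤ Φ₀) :
    |(∫ x, Real.exp (-(β * (f x - f (σ 0)))) * φ x ∂μ) - ν.real univ * (w₀ * ((2 * π / β) ^ ((finrank ℝ V : ℝ) / 2) / Real.sqrt (LinearMap.det A)))| ≤
      (16 * ((finrank ℝ V : ℝ) + 8) / (lam * R ^ 2) + 16 * G * ((finrank ℝ V : ℝ) + 8) / lam
        + 256 * (A₄ + (A₃ + A₄ * R) * (D + G * R)) * ((finrank ℝ V : ℝ) + 8) ^ 2 / lam ^ 2
        + 18432 * (A₃ + A₄ * R) ^ 2 * ((finrank ℝ V : ℝ) + 8) ^ 3 / lam ^ 3) / β * (ν.real univ * (w₀ * ((2 * π / β) ^ ((finrank ℝ V : ℝ) / 2) / Real.sqrt (LinearMap.det A)))) + Φ₀ * μ.real univ * Real.exp (-(β * η₀)) := by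
  obtain ⟨hTint, htube⟩ := laplaceMethod_quantitative_orbit_tube hact hmul hone hpres hσ hΘ hΘm hΘ' hΘ'm hR
    hslice hfix hT hA hΦ hJm hJ0 hJint hloc hc0 hctop hfm hφm hfinv hφinv hAs hlam hcoer hA₃ hA₄ hD hG hβ hw₀
    hsmall hDR hGR hc_meas hr_meas hℓ_meas he_meas hc_odd hℓ_odd hc hr hℓ he hf hw
  set T : Set X := Θ '' (univ ×ˢ closedBall (0 : V) R) with hTdef
  set F : X → ℝ := fun x => Real.exp (-(β * (f x - f (σ 0)))) * φ x with hFdef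
  have hΦ₀ : 0 ≤ Φ₀ := (abs_nonneg _).trans (hφb (σ 0))
  have hFm : Measurable F := (((hfm.sub measurable_const).const_mul β).neg.exp).mul hφm
  have hFout : ∀ x, x ∉ T → |F x| ≤ Φ₀ * Real.exp (-(β * η₀)) := by
    intro x hx
    have h1 : Real.exp (-(β * (f x - f (σ 0)))) ≤ Real.exp (-(β * η₀)) := by
      rw [Real.exp_le_exp]
      have := hout x hx
      nlinarith
    simp only [hFdef]
    rw [abs_mul, abs_of_pos (Real.exp_pos _), mul_comm]
    exact mul_le_mul (hφb x) h1 (Real.exp_pos _).le hΦ₀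
  have hTcint : IntegrableOn F Tᶜ μ :=
    Measure.integrableOn_of_bounded (measure_ne_top μ _) hFm.aestronglyMeasurable
      ((ae_restrict_iff' hT.compl).mpr (Eventually.of_forall fun x hx => by
        rw [Real.norm_eq_abs]; exact hFout x hx))
  have hFint : Integrable F μ := by
    have h := hTint.union hTcint
    rwa [union_compl_self, integrableOn_univ] at h
  have htail : |∫ x in Tᶜ, F x ∂μ| ≤ Φ₀ * μ.real univ * Real.exp (-(β * η₀)) := by
    have h1 : ‖∫ x in Tᶜ, F x ∂μ‖ ≤ (Φ₀ * Real.exp (-(β * η₀))) * μ.real Tᶜ :=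
      norm_setIntegral_le_of_norm_le_const (measure_lt_top μ _) fun x hx => by
        rw [Real.norm_eq_abs]; exact hFout x hx
    rw [Real.norm_eq_abs] at h1
    have h2 : μ.real Tᶜ ≤ μ.real univ := measureReal_mono (subset_univ _)
    calc |∫ x in Tᶜ, F x ∂μ| ≤ (Φ₀ * Real.exp (-(β * η₀))) * μ.real Tᶜ := h1
      _ ≤ (Φ₀ * Real.exp (-(β * η₀))) * μ.real univ := by gcongr
      _ = Φ₀ * μ.real univ * Real.exp (-(β * η₀)) := by ring
  have hsplit : ∫ x, F x ∂μ = (∫ x in T, F x ∂μ) + ∫ x in Tᶜ, F x ∂μ := (integral_add_compl hT hFint).symm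
  rw [hsplit]
  calc |(∫ x in T, F x ∂μ) + (∫ x in Tᶜ, F x ∂μ) - ν.real univ * (w₀ * ((2 * π / β) ^ ((finrank ℝ V : ℝ) / 2) / Real.sqrt (LinearMap.det A)))|
      = |((∫ x in T, F x ∂μ) - ν.real univ * (w₀ * ((2 * π / β) ^ ((finrank ℝ V : ℝ) / 2) / Real.sqrt (LinearMap.det A)))) + ∫ x in Tᶜ, F x ∂μ| := by ring_nf
    _ ≤ |(∫ x in T, F x ∂μ) - ν.real univ * (w₀ * ((2 * π / β) ^ ((finrank ℝ V : ℝ) / 2) / Real.sqrt (LinearMap.det A)))| + |∫ x in Tᶜ, F x ∂μ| := abs_add_le _ _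
    _ ≤ _ := add_le_add htube htail

/-! ## §2 Several tubes: the contributions add (quantitative twin of `tendsto_laplaceMethod_sum_of_tubes`) -/

section SumOfTubes

variable {Y : Type*} [MeasurableSpace Y] {ρ : Measure Y} [IsFiniteMeasure ρ]

/-- ★ **Bookkeeping over finitely many disjoint tubes, quantitatively.**  For a finite measure `ρ`, finitely many
pairwise disjoint measurable sets `T i`, a measurable `F` integrable on each `T i` with per-tube estimates
`|∫_{T i} F − ℓ i| ≤ ε i`, and a uniform bound `|F| ≤ M` (`M ≥ 0`) OFF `⋃ T i` (for the Laplace weight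
`F = e^{−β(f−f₀)}φ` separated by `η₀` off the tubes: `M = Φ₀e^{−βη₀}`):
`|∫ F dρ − Σ ℓ i| ≤ Σ ε i + M·ρ(Y)` (the quantitative form of «the contributions of the several minimum points
are added»). [cite: Breitung1994, Thm 56 (6.31)] [cite: HasenpflugRudolfSprungk2024, §3.4] -/
theorem laplaceMethod_quantitative_sum_of_tubes {ι : Type*} [Fintype ι] {T : ι → Set Y}
    (hTm : ∀ i, MeasurableSet (T i)) (hdisj : Pairwise fun i i' => Disjoint (T i) (T i'))
    {F : Y → ℝ} (hFm : Measurable F) (hFi : ∀ i, IntegrableOn F (T i) ρ)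
    {ℓ ε : ι → ℝ} (hle : ∀ i, |(∫ x in T i, F x ∂ρ) - ℓ i| ≤ ε i)
    {M : ℝ} (hM : 0 ≤ M) (hout : ∀ x, x ∉ (⋃ i, T i) → |F x| ≤ M) :
    |(∫ x, F x ∂ρ) - ∑ i, ℓ i| ≤ (∑ i, ε i) + M * ρ.real univ := by
  classical
  set U : Set Y := ⋃ i, T i with hU
  have hUm : MeasurableSet U := MeasurableSet.iUnion hTm
  have hUint : IntegrableOn F U ρ := by
    rw [hU]; exact (integrableOn_finite_iUnion).mpr hFi
  have hUsum : ∫ x in U, F x ∂ρ = ∑ i, ∫ x in T i, F x ∂ρ := by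
    rw [hU]; exact integral_iUnion_fintype hTm (fun i i' hne => hdisj hne) hFi
  have hUcint : IntegrableOn F Uᶜ ρ :=
    Measure.integrableOn_of_bounded (M := M) (measure_ne_top ρ _) hFm.aestronglyMeasurable
      ((ae_restrict_iff' hUm.compl).mpr (Eventually.of_forall fun x hx => by
        rw [Real.norm_eq_abs]; exact hout x hx))
  have hFint : Integrable F ρ := by
    have h := hUint.union hUcint
    rwa [union_compl_self, integrableOn_univ] at h
  have htail : |∫ x in Uᶜ, F x ∂ρ| ≤ M * ρ.real univ := by
    have h1 : ‖∫ x in Uᶜ, F x ∂ρ‖ ≤ M * ρ.real Uᶜ :=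
      norm_setIntegral_le_of_norm_le_const (measure_lt_top ρ _) fun x hx => by
        rw [Real.norm_eq_abs]; exact hout x hx
    rw [Real.norm_eq_abs] at h1
    exact h1.trans (mul_le_mul_of_nonneg_left (measureReal_mono (subset_univ _)) hM)
  have hsplit : ∫ x, F x ∂ρ = (∫ x in U, F x ∂ρ) + ∫ x in Uᶜ, F x ∂ρ := (integral_add_compl hUm hFint).symm
  have hsum : |(∑ i, ∫ x in T i, F x ∂ρ) - ∑ i, ℓ i| ≤ ∑ i, ε i := by
    rw [← Finset.sum_sub_distrib]
    exact (Finset.abs_sum_le_sum_abs _ _).trans (Finset.sum_le_sum fun i _ => hle i)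
  rw [hsplit, hUsum]
  calc |(∑ i, ∫ x in T i, F x ∂ρ) + (∫ x in Uᶜ, F x ∂ρ) - ∑ i, ℓ i|
      = |((∑ i, ∫ x in T i, F x ∂ρ) - ∑ i, ℓ i) + ∫ x in Uᶜ, F x ∂ρ| := by ring_nf
    _ ≤ |(∑ i, ∫ x in T i, F x ∂ρ) - ∑ i, ℓ i| + |∫ x in Uᶜ, F x ∂ρ| := abs_add_le _ _
    _ ≤ _ := add_le_add hsum htail

end SumOfTubes

end Summit.QuantumFields.YangMills.Theorems.QuantitativeLaplace
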